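/-
Copyright (c) 2026 the pub-hodgecm-mathlib formalisation cell (harness21).  Prover seat hodgecm-mathlib-K2Liu-p14 (g2): Track B «K2-LIT»,
hLiu418 = stmt-HodgeConjecture-24832; LEAD F0P6-plan (g13) RULING M-157b (β4)∕(β5) + 09:48:19Z (3) «(β4-iv) CM-arch instantiation from ★ (β5)», file (β4-iv) B.
-/
import Summits.HodgeConjecture.HodgeConjecture.Theorems.K2LiuMixedSpaceGodementMonomials     -- (β4-iv) A: Schwartz data, arch Godement integrals
import Summits.HodgeConjecture.HodgeConjecture.Theorems.K2LiuGL2GodementSectionOfFlatArch      -- ★ (β5) `circle_chars_linearIndependent`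
import Mathlib.LinearAlgebra.UnitaryGroup
import HarnessLib

/-!
# Crux `HLiu418`, road `K2_Liu`, Road Φ organ G5 (β) «Godement sections exhaust», file (β4-iv) B:
# GODEMENT SECTIONS OF FLAT `K_∞`-FINITE SECTIONS OF `GL₂(K_∞)`, `K_∞ = ∏_{v} U(2)` — ALL COMPLEX PLACES AT ONCE (totally complex `L`)

Cell `hodgecm-mathlib`, crux item hLiu418 = `stmt-HodgeConjecture-24832`; prover K2Liu-p14 (g2).  THEOREMS ONLY (no `def`, no instance, no notation,
no named-fact hypothesis, no `sorry`); lane `--supports stmt-HodgeConjecture-24832` (count-neutral helper).  The multi-place twin of ★ (β5)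
`K2LiuGL2GodementSectionOfFlatArch` in the currency of ★ (β4-iii) `K2LiuGL2GodementSectionsExhaustGlobal.exists_godement_exhaust`: `K_∞ = Kinf 2 L` is the unitary group
of the star ring `A = mixedSpace L = ℂ^{r₂}` (★ `Kinf_eq_unitarySubgroupGL`), so the `U(2)` plumbing of ★ (β5) §4 runs VERBATIM over `A` (§1), the circle
`U(1)` becomes the torus `unitary A = U(1)^{r₂}` (§2: invariance under the torus kills the monomials that are unbalanced at SOME place — characters of
`U(1)^{r₂}`, reduced to ★ (β5) `circle_chars_linearIndependent` one place at a time), and the Γ-factors multiply over the places ((β4-iv) A).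
* §1 `U(2, A)` plumbing over a commutative star ring `A`: `kappa_mem_unitaryGroup`, `apply_eq_apply_kappa` (a flat `F₀` only sees the bottom row), `apply_kappa_smul`
  (torus invariance of `F₀ ∘ κ`).
* §2 `eval_eq_sum_balanced_of_torus_invariant` — a polynomial `Q(x, x̄)` in the coordinates `x_{v,l}` invariant under `x_{v,l} ↦ u_v x_{v,l}` (`u ∈ U(1)^{r₂}`) equals at `x`
  the sum of its monomials balanced at every place.
* §3 `eval_kappa` — `F₀ ∘ κ` is an explicit polynomial `bind₁ θ P` in the bottom-row coordinates.
* §4 MAIN **`exists_godement_arch_of_flat_polynomial_cm`** — for `F₀ : U(2, A) → ℂ` flat (`hB`) and polynomial in the entries (`hF`, the ★ (K∞-str) face of K2Liu-p05)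
  there are finitely many monomial × Gaussian Schwartz data `Φ_m` ((β4-iv) A) and ENTIRE inverse coefficients `(A_m w)⁻¹` with, for every Haar `μ` on `K_∞ˣ`, every
  `w` with `0 < re w` and every `k ∈ U(2, A)`:  `F₀ k = Σ_m (A_m w)⁻¹ ∫_{K_∞ˣ} Φ_m(x · e₂ k) N(x)^w dμ(x)`, the integrands integrable — EXACTLY the `hK`∕`hgi`∕`hAinv`
  letters of ★ (β4-iii) at `w = 2s + 1`, `k = GLn.toMixed 2 L k'`.
[cite: JacquetLanglands1970, §5–§6] [cite: Tate1950, §2.5] [cite: Bump1997, §2.8, §3.7] [cite: CogdellAnalyticTheory2004, §2.3].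
HONEST LABEL.  `HC_CM` is proved only modulo the 7 printed citations (2 remaining named inputs: hLiu418 = `stmt-HodgeConjecture-24832`,
h413 = `stmt-HodgeConjecture-24833`) until rung 0 closes.
-/

set_option autoImplicit false
set_option linter.dupNamespace false -- the mandated namespace repeats `HodgeConjecture.HodgeConjecture`

noncomputable section

open MeasureTheory Measure NumberField NumberField.InfinitePlace NumberField.mixedEmbedding Set Complex MvPolynomial
open scoped NNReal ENNReal Classical ComplexConjugate Real Matrix
open Literature.NumberTheory.Automorphic
open Summit.HodgeConjecture.HodgeConjecture.Cruxes.HLiu418.K2LiuGL2GodementSectionOfFlatArch (circle_chars_linearIndependent)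
open Summit.HodgeConjecture.HodgeConjecture.Cruxes.HLiu418.K2LiuMixedSpaceGodementMonomials

namespace Summit.HodgeConjecture.HodgeConjecture.Cruxes.HLiu418.K2LiuGL2GodementSectionOfFlatArchCM

/-! ## §1 `U(2, A)` plumbing over a commutative star ring: the lift `κ(x) = !![x₁*, −x₀*; x₀, x₁]` -/

section Unitary

variable {A : Type*} [CommRing A] [StarRing A]

/-- the `(1,0)` entry of `M · Nᴴ` for `2 × 2` matrices over a star ring. [folklore] -/
theorem mul_star_apply_one_zero (M N : Matrix (Fin 2) (Fin 2) A) :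
    (M * star N) 1 0 = M 1 0 * star (N 0 0) + M 1 1 * star (N 0 1) := by
  rw [Matrix.star_eq_conjTranspose, Matrix.mul_apply, Fin.sum_univ_two, Matrix.conjTranspose_apply, Matrix.conjTranspose_apply]

/-- the `(1,1)` entry of `M · Mᴴ`. [folklore] -/
theorem mul_star_apply_one_one (M : Matrix (Fin 2) (Fin 2) A) :
    (M * star M) 1 1 = M 1 0 * star (M 1 0) + M 1 1 * star (M 1 1) := by
  rw [Matrix.star_eq_conjTranspose, Matrix.mul_apply, Fin.sum_univ_two, Matrix.conjTranspose_apply, Matrix.conjTranspose_apply]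

/-- the bottom row of a unitary matrix is a unit vector: `k₁₀ k₁₀* + k₁₁ k₁₁* = 1`. [folklore] -/
theorem row_one_mul_star_eq_one (k : Matrix.unitaryGroup (Fin 2) A) :
    (k : Matrix (Fin 2) (Fin 2) A) 1 0 * star ((k : Matrix (Fin 2) (Fin 2) A) 1 0) +
      (k : Matrix (Fin 2) (Fin 2) A) 1 1 * star ((k : Matrix (Fin 2) (Fin 2) A) 1 1) = 1 := by
  have h := Matrix.mem_unitaryGroup_iff.1 k.2
  have h11 := congrFun (congrFun h 1) 1
  rw [mul_star_apply_one_one, Matrix.one_apply_eq] at h11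
  exact h11

/-- **the lift of a unit row is unitary**: `κ(x) κ(x)ᴴ = 1` for `x₀ x₀* + x₁ x₁* = 1`. [folklore] -/
theorem kappa_mem_unitaryGroup {x : Fin 2 → A} (hx : x 0 * star (x 0) + x 1 * star (x 1) = 1) :
    !![star (x 1), -star (x 0); x 0, x 1] ∈ Matrix.unitaryGroup (Fin 2) A := by
  rw [Matrix.mem_unitaryGroup_iff, ← Matrix.ext_iff]
  intro i j
  fin_cases i <;> fin_cases j <;>
    simp [Matrix.mul_apply, Fin.sum_univ_two, Matrix.star_eq_conjTranspose, Matrix.conjTranspose_apply] <;>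
    first | ring1 | linear_combination hx
/-- flatness in use: `F₀ k = F₀ k′` whenever `(k k′ᴴ)₁₀ = 0` (then `k k′⁻¹` is upper triangular unitary). [cite: JacquetLanglands1970, §5] -/
theorem apply_eq_of_mul_star_one_zero {F₀ : Matrix.unitaryGroup (Fin 2) A → ℂ}
    (hB : ∀ p k : Matrix.unitaryGroup (Fin 2) A, (p : Matrix (Fin 2) (Fin 2) A) 1 0 = 0 → F₀ (p * k) = F₀ k)
    (k k' : Matrix.unitaryGroup (Fin 2) A) (h : ((k : Matrix (Fin 2) (Fin 2) A) * star (k' : Matrix (Fin 2) (Fin 2) A)) 1 0 = 0) :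
    F₀ k = F₀ k' := by
  have hk : k = (k * star k') * k' := by rw [mul_assoc, Unitary.star_mul_self, mul_one]
  rw [hk]
  exact hB (k * star k') k' h

/-- **`F₀ k = F₀ κ(e₂ k)`** — a flat function on `U(2, A)` only sees the bottom row (`(k κ(e₂k)ᴴ)₁₀ = k₁₀k₁₁ − k₁₁k₁₀ = 0`).
[cite: JacquetLanglands1970, §5] [cite: Bump1997, §2.8] -/
theorem apply_eq_apply_kappa {F₀ : Matrix.unitaryGroup (Fin 2) A → ℂ}
    (hB : ∀ p k : Matrix.unitaryGroup (Fin 2) A, (p : Matrix (Fin 2) (Fin 2) A) 1 0 = 0 → F₀ (p * k) = F₀ k)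
    (k : Matrix.unitaryGroup (Fin 2) A) :
    F₀ k = F₀ ⟨!![star ((k : Matrix (Fin 2) (Fin 2) A) 1 1), -star ((k : Matrix (Fin 2) (Fin 2) A) 1 0);
        (k : Matrix (Fin 2) (Fin 2) A) 1 0, (k : Matrix (Fin 2) (Fin 2) A) 1 1], kappa_mem_unitaryGroup (row_one_mul_star_eq_one k)⟩ := by
  refine apply_eq_of_mul_star_one_zero hB k _ ?_
  rw [mul_star_apply_one_zero]
  simp only [Matrix.of_apply, Matrix.cons_val', Matrix.cons_val_zero, Matrix.cons_val_one, Matrix.empty_val', Matrix.cons_val_fin_one,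
    star_neg, star_star]
  ring

/-- the lift of `u • x` for `u` in the scalar torus `unitary A` is again unitary. [folklore] -/
theorem smul_row_mul_star_eq_one {u : A} (hu : u ∈ unitary A) {x : Fin 2 → A} (hx : x 0 * star (x 0) + x 1 * star (x 1) = 1) :
    (u • x) 0 * star ((u • x) 0) + (u • x) 1 * star ((u • x) 1) = 1 := by
  have hu' : u * star u = 1 := Unitary.mul_star_self_of_mem hu
  simp only [Pi.smul_apply, smul_eq_mul, star_mul]
  linear_combination (norm := ring_nf) u * star u * hx + hu'

/-- **torus invariance of `F₀ ∘ κ`**: `κ(u x) = diag(u*, u) κ(x)`, so `F₀ κ(u x) = F₀ κ(x)` for `u ∈ unitary A` (`(κ(ux) κ(x)ᴴ)₁₀ = u(x₀x₁ − x₁x₀) = 0`).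
[cite: JacquetLanglands1970, §6] -/
theorem apply_kappa_smul {F₀ : Matrix.unitaryGroup (Fin 2) A → ℂ}
    (hB : ∀ p k : Matrix.unitaryGroup (Fin 2) A, (p : Matrix (Fin 2) (Fin 2) A) 1 0 = 0 → F₀ (p * k) = F₀ k)
    {u : A} (hu : u ∈ unitary A) {x : Fin 2 → A} (hx : x 0 * star (x 0) + x 1 * star (x 1) = 1) :
    F₀ ⟨!![star ((u • x) 1), -star ((u • x) 0); (u • x) 0, (u • x) 1], kappa_mem_unitaryGroup (smul_row_mul_star_eq_one hu hx)⟩ =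
      F₀ ⟨!![star (x 1), -star (x 0); x 0, x 1], kappa_mem_unitaryGroup hx⟩ := by
  refine apply_eq_of_mul_star_one_zero hB _ _ ?_
  rw [mul_star_apply_one_zero]
  simp only [Matrix.of_apply, Matrix.cons_val', Matrix.cons_val_zero, Matrix.cons_val_one, Matrix.empty_val', Matrix.cons_val_fin_one,
    star_neg, star_star, Pi.smul_apply, smul_eq_mul]
  ring

end Unitary

/-! ## §2 Torus invariance kills the monomials unbalanced at some place -/

section Torus

variable {P : Type} [Fintype P]

/-- the torus characters `u ↦ ∏_v u_v^{d_v}` (`d : P → ℤ`) of `U(1)^P` are linearly independent over `ℂ` (Dedekind; injectivity of `d ↦ χ_d` one coordinate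
at a time by ★ (β5) `circle_chars_linearIndependent`). [folklore] -/
theorem torus_chars_linearIndependent : LinearIndependent ℂ (fun d : P → ℤ => fun u : P → Circle => ∏ v, ((u v : ℂ) ^ d v)) := by
  set χ : (P → ℤ) → ((P → Circle) →* ℂ) := fun d =>
    { toFun := fun u => ∏ v, ((u v : ℂ) ^ d v)
      map_one' := by simp
      map_mul' := fun u u' => by
        rw [← Finset.prod_mul_distrib]
        exact Finset.prod_congr rfl fun v _ => by rw [Pi.mul_apply, Circle.coe_mul, mul_zpow] } with hχ
  have hχapp : ∀ d (u : P → Circle), χ d u = ∏ v, ((u v : ℂ) ^ d v) := fun d u => rfl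
  have hinj : Function.Injective χ := by
    intro d d' h
    funext v
    -- restrict to the `v`-th coordinate circle
    have hv : (fun t : Circle => ((t : ℂ) ^ d v)) = fun t : Circle => ((t : ℂ) ^ d' v) := by
      funext t
      have h1 := congrArg (fun f : (P → Circle) →* ℂ => f (Pi.mulSingle v t)) h
      simp only [hχapp] at h1
      rwa [Finset.prod_eq_single v (fun v' _ hv' => by rw [Pi.mulSingle_eq_of_ne hv', Circle.coe_one, one_zpow]) (fun h => (h (Finset.mem_univ v)).elim),
        Finset.prod_eq_single v (fun v' _ hv' => by rw [Pi.mulSingle_eq_of_ne hv', Circle.coe_one, one_zpow]) (fun h => (h (Finset.mem_univ v)).elim),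
        Pi.mulSingle_eq_same] at h1
    exact circle_chars_linearIndependent.injective hv
  have hli := (linearIndependent_monoidHom (P → Circle) ℂ).comp χ hinj
  have heq : (fun d : P → ℤ => fun u : P → Circle => ∏ v, ((u v : ℂ) ^ d v)) = (fun f : (P → Circle) →* ℂ => (f : (P → Circle) → ℂ)) ∘ χ := by
    funext d u; exact (hχapp d u).symm
  rw [heq]; exact hli

variable {ι₂ : Type} [Fintype ι₂]

/-- a monomial in the coordinates `x_{v,l}` (`inl (v,l)`) and their conjugates (`inr (v,l)`) scales under `x_{v,l} ↦ u_v x_{v,l}`, `u ∈ U(1)^P`, by the character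
`∏_v u_v^{δ_v(m)}`, `δ_v(m) = Σ_l m(inl (v,l)) − Σ_l m(inr (v,l))`. [folklore] -/
theorem eval_monomial_torus_smul (m : ((P × ι₂) ⊕ (P × ι₂)) →₀ ℕ) (c : ℂ) (u : P → Circle) (x : P × ι₂ → ℂ) :
    eval (Sum.elim (fun vl : P × ι₂ => (u vl.1 : ℂ) * x vl) (fun vl : P × ι₂ => conj ((u vl.1 : ℂ) * x vl))) (monomial m c) =
      (∏ v, ((u v : ℂ) ^ (((∑ l, m (Sum.inl (v, l)) : ℕ) : ℤ) - ((∑ l, m (Sum.inr (v, l)) : ℕ) : ℤ)))) *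
        eval (Sum.elim x (fun vl : P × ι₂ => conj (x vl))) (monomial m c) := by
  rw [eval_monomial_eq_prod, eval_monomial_eq_prod]
  simp only [Sum.elim_inl, Sum.elim_inr, map_mul, mul_pow, Finset.prod_mul_distrib]
  have hu : ∀ v, conj (u v : ℂ) = ((u v : ℂ))⁻¹ := fun v => (Circle.coe_inv_eq_conj (u v)).symm ▸ (Circle.coe_inv (u v)).symm ▸ rfl
  have h1 : (∏ vl : P × ι₂, (u vl.1 : ℂ) ^ m (Sum.inl vl)) = ∏ v, (u v : ℂ) ^ (∑ l, m (Sum.inl (v, l))) := by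
    rw [Fintype.prod_prod_type]; exact Finset.prod_congr rfl fun v _ => by simp only [Finset.prod_pow_eq_pow_sum]
  have h2 : (∏ vl : P × ι₂, conj (u vl.1 : ℂ) ^ m (Sum.inr vl)) = ∏ v, ((u v : ℂ))⁻¹ ^ (∑ l, m (Sum.inr (v, l))) := by
    rw [Fintype.prod_prod_type]; exact Finset.prod_congr rfl fun v _ => by simp only [Finset.prod_pow_eq_pow_sum, hu]
  rw [h1, h2]
  have h3 : ∀ v, (u v : ℂ) ^ (((∑ l, m (Sum.inl (v, l)) : ℕ) : ℤ) - ((∑ l, m (Sum.inr (v, l)) : ℕ) : ℤ)) =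
      (u v : ℂ) ^ (∑ l, m (Sum.inl (v, l))) * ((u v : ℂ))⁻¹ ^ (∑ l, m (Sum.inr (v, l))) := fun v => by
    rw [zpow_sub₀ (Circle.coe_ne_zero (u v)), zpow_natCast, zpow_natCast, div_eq_mul_inv, inv_pow]
  simp_rw [h3, Finset.prod_mul_distrib]
  ring

/-- **TORUS INVARIANCE KILLS THE MONOMIALS UNBALANCED AT SOME PLACE**: if `Q(x, x̄)` satisfies `Q(u • x) = Q(x)` for every `u ∈ U(1)^P` then at `x` it equals
the sum of its monomials with `Σ_l m(inl (v,l)) = Σ_l m(inr (v,l))` at EVERY `v` (expand along the torus characters; they are independent).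
The multi-place twin of ★ (β5) `eval_eq_sum_diagonal_of_circle_invariant`. [cite: JacquetLanglands1970, §6] -/
theorem eval_eq_sum_balanced_of_torus_invariant (Q : MvPolynomial ((P × ι₂) ⊕ (P × ι₂)) ℂ) (x : P × ι₂ → ℂ)
    (hQ : ∀ u : P → Circle, eval (Sum.elim (fun vl : P × ι₂ => (u vl.1 : ℂ) * x vl) (fun vl : P × ι₂ => conj ((u vl.1 : ℂ) * x vl))) Q =
      eval (Sum.elim x (fun vl : P × ι₂ => conj (x vl))) Q) :
    eval (Sum.elim x (fun vl : P × ι₂ => conj (x vl))) Q =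
      ∑ m ∈ Q.support with ∀ v, ∑ l, m (Sum.inl (v, l)) = ∑ l, m (Sum.inr (v, l)),
        eval (Sum.elim x (fun vl : P × ι₂ => conj (x vl))) (monomial m (Q.coeff m)) := by
  -- bidegree defect `δ m : P → ℤ`, values `e m`
  set δ : (((P × ι₂) ⊕ (P × ι₂)) →₀ ℕ) → P → ℤ := fun m v => ((∑ l, m (Sum.inl (v, l)) : ℕ) : ℤ) - ((∑ l, m (Sum.inr (v, l)) : ℕ) : ℤ) with hδ
  set e : (((P × ι₂) ⊕ (P × ι₂)) →₀ ℕ) → ℂ := fun m => eval (Sum.elim x (fun vl : P × ι₂ => conj (x vl))) (monomial m (Q.coeff m)) with he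
  set D : Finset (P → ℤ) := insert 0 (Q.support.image δ) with hD
  set g : (P → ℤ) → ℂ := fun d => (∑ m ∈ Q.support with δ m = d, e m) - if d = 0 then eval (Sum.elim x (fun vl : P × ι₂ => conj (x vl))) Q else 0 with hg
  -- `Q(u • x)` expanded along the characters
  have hexp : ∀ u : P → Circle, eval (Sum.elim (fun vl : P × ι₂ => (u vl.1 : ℂ) * x vl) (fun vl : P × ι₂ => conj ((u vl.1 : ℂ) * x vl))) Q =
      ∑ d ∈ D, (∏ v, ((u v : ℂ) ^ d v)) * ∑ m ∈ Q.support with δ m = d, e m := by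
    intro u
    conv_lhs => rw [Q.as_sum]
    rw [_root_.map_sum]
    have hterm : ∀ m ∈ Q.support, eval (Sum.elim (fun vl : P × ι₂ => (u vl.1 : ℂ) * x vl) (fun vl : P × ι₂ => conj ((u vl.1 : ℂ) * x vl)))
        (monomial m (Q.coeff m)) = (∏ v, ((u v : ℂ) ^ δ m v)) * e m := fun m _ => eval_monomial_torus_smul m (Q.coeff m) u x
    rw [Finset.sum_congr rfl hterm]
    symm
    calc ∑ d ∈ D, (∏ v, ((u v : ℂ) ^ d v)) * ∑ m ∈ Q.support with δ m = d, e m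
        = ∑ d ∈ D, ∑ m ∈ Q.support with δ m = d, (∏ v, ((u v : ℂ) ^ δ m v)) * e m := by
          refine Finset.sum_congr rfl fun d _ => ?_
          rw [Finset.mul_sum]
          refine Finset.sum_congr rfl fun m hm => ?_
          rw [(Finset.mem_filter.1 hm).2]
      _ = ∑ m ∈ Q.support, (∏ v, ((u v : ℂ) ^ δ m v)) * e m :=
          Finset.sum_fiberwise_of_maps_to (fun m hm => Finset.mem_insert_of_mem (Finset.mem_image_of_mem δ hm)) _
  -- the linear relation among the characters
  have h0D : (0 : P → ℤ) ∈ D := Finset.mem_insert_self _ _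
  have hrel : ∑ d ∈ D, g d • (fun u : P → Circle => ∏ v, ((u v : ℂ) ^ d v)) = 0 := by
    funext u
    simp only [Finset.sum_apply, Pi.smul_apply, smul_eq_mul, Pi.zero_apply, hg, sub_mul, Finset.sum_sub_distrib, ite_mul, zero_mul]
    rw [Finset.sum_ite_eq' D (0 : P → ℤ), if_pos h0D]
    simp only [Pi.zero_apply, zpow_zero, Finset.prod_const_one, mul_one]
    rw [show ∑ d ∈ D, (∑ m ∈ Q.support with δ m = d, e m) * ∏ v, ((u v : ℂ) ^ d v) = ∑ d ∈ D, (∏ v, ((u v : ℂ) ^ d v)) * ∑ m ∈ Q.support with δ m = d, e m from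
        Finset.sum_congr rfl fun d _ => mul_comm _ _, ← hexp u, hQ u, sub_self]
  have hg0 : g 0 = 0 := linearIndependent_iff'.1 torus_chars_linearIndependent D g hrel 0 h0D
  simp only [hg, if_true, sub_eq_zero] at hg0
  rw [← hg0]
  refine Finset.sum_congr ?_ fun m _ => rfl
  refine Finset.filter_congr fun m _ => ?_
  simp only [hδ, _root_.funext_iff, Pi.zero_apply, sub_eq_zero, Nat.cast_inj]

end Torus

/-! ## §3 `F₀ ∘ κ` is a polynomial in the bottom-row coordinates -/

section Kappa

variable {L : Type} [Field L] [NumberField L]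

omit [NumberField L] in
/-- **`P ∘ κ` is the polynomial `bind₁ θ P` in `(x, x̄)`**: the entries of `κ(x) = !![x₁*, −x₀*; x₀, x₁]` over `mixedSpace L` at a complex place `v` are
`x̄_{v,1}, −x̄_{v,0}, x_{v,0}, x_{v,1}` and their conjugates (explicit substitution `θ`). [cite: JacquetLanglands1970, §6] -/
theorem eval_kappa (P : MvPolynomial (({v : InfinitePlace L // v.IsComplex} × (Fin 2 × Fin 2)) ⊕ ({v : InfinitePlace L // v.IsComplex} × (Fin 2 × Fin 2))) ℂ)
    (x : Fin 2 → mixedSpace L) :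
    eval (Sum.elim
        (fun w : {v : InfinitePlace L // v.IsComplex} × (Fin 2 × Fin 2) =>
          ((!![star (x 1), -star (x 0); x 0, x 1] : Matrix (Fin 2) (Fin 2) (mixedSpace L)) w.2.1 w.2.2).2 w.1)
        (fun w : {v : InfinitePlace L // v.IsComplex} × (Fin 2 × Fin 2) =>
          conj (((!![star (x 1), -star (x 0); x 0, x 1] : Matrix (Fin 2) (Fin 2) (mixedSpace L)) w.2.1 w.2.2).2 w.1))) P =
      eval (Sum.elim (fun vl : {v : InfinitePlace L // v.IsComplex} × Fin 2 => (x vl.2).2 vl.1)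
          (fun vl : {v : InfinitePlace L // v.IsComplex} × Fin 2 => conj ((x vl.2).2 vl.1)))
        (bind₁ (Sum.elim
          (fun w : {v : InfinitePlace L // v.IsComplex} × (Fin 2 × Fin 2) =>
            (!![X (Sum.inr (w.1, 1)), -X (Sum.inr (w.1, 0)); X (Sum.inl (w.1, 0)), X (Sum.inl (w.1, 1))] :
              Matrix (Fin 2) (Fin 2) (MvPolynomial (({v : InfinitePlace L // v.IsComplex} × Fin 2) ⊕ ({v : InfinitePlace L // v.IsComplex} × Fin 2)) ℂ)) w.2.1 w.2.2)
          (fun w : {v : InfinitePlace L // v.IsComplex} × (Fin 2 × Fin 2) =>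
            (!![X (Sum.inl (w.1, 1)), -X (Sum.inl (w.1, 0)); X (Sum.inr (w.1, 0)), X (Sum.inr (w.1, 1))] :
              Matrix (Fin 2) (Fin 2) (MvPolynomial (({v : InfinitePlace L // v.IsComplex} × Fin 2) ⊕ ({v : InfinitePlace L // v.IsComplex} × Fin 2)) ℂ)) w.2.1 w.2.2)) P) := by
  rw [Literature.NumberTheory.Automorphic.eval_bind₁]
  refine congrFun (congrArg (fun f => (eval f : MvPolynomial _ ℂ → ℂ)) ?_) P
  funext w
  rcases w with ⟨v, i, j⟩ | ⟨v, i, j⟩ <;> fin_cases i <;> fin_cases j <;>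
    simp [Matrix.of_apply, Matrix.cons_val', Matrix.cons_val_zero, Matrix.cons_val_one, Matrix.empty_val', Matrix.cons_val_fin_one, eval_X,
      Prod.snd_star, Prod.snd_neg, Pi.star_apply, Pi.neg_apply]

end Kappa

/-! ## §4 MAIN: Godement sections exhaust the flat `K_∞`-finite sections of `GL₂(K_∞)`, all complex places at once -/

section Main

variable {L : Type} [Field L] [NumberField L] [IsTotallyComplex L]

omit [NumberField L] [IsTotallyComplex L] in
/-- the complex components of a unit row of `(mixedSpace L)²`: `|x_{v,0}|² + |x_{v,1}|² = 1` at every complex place. [folklore] -/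
theorem norm_sq_add_of_row_mul_star {x : Fin 2 → mixedSpace L} (hx : x 0 * star (x 0) + x 1 * star (x 1) = 1) (v : {v : InfinitePlace L // v.IsComplex}) :
    ‖(x 0).2 v‖ ^ 2 + ‖(x 1).2 v‖ ^ 2 = 1 := by
  have h := congrArg (fun z : mixedSpace L => z.2 v) hx
  simp only [Prod.snd_add, Prod.snd_mul, Prod.snd_star, Pi.add_apply, Pi.mul_apply, Pi.star_apply, Prod.snd_one, Pi.one_apply,
    Complex.star_def, Complex.mul_conj, Complex.normSq_eq_norm_sq] at h
  exact_mod_cast h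

/-- **GODEMENT SECTIONS EXHAUST THE FLAT `K_∞`-FINITE SECTIONS OF `GL₂(K_∞)`, `K_∞ = U(2, mixedSpace L) = ∏_v U(2)` (RULING M-157b (β5), all complex places
at once; the `hK`∕`hgi`∕`hAinv` faces of ★ (β4-iii) `exists_godement_exhaust`).**  Let `F₀ : U(2, mixedSpace L) → ℂ` be the restriction to `K_∞` of a flat section:
left-invariant under `B ∩ K_∞` (`hB`) and — `K_∞`-finiteness, the ★ (K∞-str) face of K2Liu-p05 — a POLYNOMIAL in the complex entries `(k_{ij})_v` and their conjugates
(`hF`).  Then there are finitely many monomials `m` (balanced at every place), monomial × Gaussian Schwartz data `Φ_m` on `K_∞²` ((β4-iv) A) and coefficients `A_m(w)`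
with ENTIRE inverses such that for EVERY Haar measure `μ` on `K_∞ˣ`, every `w` with `0 < re w` and every `k ∈ U(2, mixedSpace L)`:
  `F₀ k = Σ_{m ∈ ι} (A_m w)⁻¹ · ∫_{K_∞ˣ} Φ_m(x · e₂ k) N(x)^w dμ(x)`,  the integrands `μ`-integrable
(`A_m(w) = c_μ ∏_v π (2π)^{−(w+a_v(m))} Γ(w+a_v(m))`).  [cite: JacquetLanglands1970, §5–§6] [cite: Tate1950, §2.5] [cite: Bump1997, §3.7] [cite: CogdellAnalyticTheory2004, §2.3] -/
theorem exists_godement_arch_of_flat_polynomial_cm (μ : Measure (mixedSpace L)ˣ) [μ.IsHaarMeasure]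
    (F₀ : Matrix.unitaryGroup (Fin 2) (mixedSpace L) → ℂ)
    (P : MvPolynomial (({v : InfinitePlace L // v.IsComplex} × (Fin 2 × Fin 2)) ⊕ ({v : InfinitePlace L // v.IsComplex} × (Fin 2 × Fin 2))) ℂ)
    (hF : ∀ k : Matrix.unitaryGroup (Fin 2) (mixedSpace L), F₀ k = eval (Sum.elim
      (fun w : {v : InfinitePlace L // v.IsComplex} × (Fin 2 × Fin 2) => ((k : Matrix (Fin 2) (Fin 2) (mixedSpace L)) w.2.1 w.2.2).2 w.1)
      (fun w : {v : InfinitePlace L // v.IsComplex} × (Fin 2 × Fin 2) => conj (((k : Matrix (Fin 2) (Fin 2) (mixedSpace L)) w.2.1 w.2.2).2 w.1))) P)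
    (hB : ∀ p k : Matrix.unitaryGroup (Fin 2) (mixedSpace L), (p : Matrix (Fin 2) (Fin 2) (mixedSpace L)) 1 0 = 0 → F₀ (p * k) = F₀ k) :
    ∃ (ι : Finset ((({v : InfinitePlace L // v.IsComplex} × Fin 2) ⊕ ({v : InfinitePlace L // v.IsComplex} × Fin 2)) →₀ ℕ))
      (Φ : ((({v : InfinitePlace L // v.IsComplex} × Fin 2) ⊕ ({v : InfinitePlace L // v.IsComplex} × Fin 2)) →₀ ℕ) → SchwartzMap (Fin 2 → mixedSpace L) ℂ)
      (A : ((({v : InfinitePlace L // v.IsComplex} × Fin 2) ⊕ ({v : InfinitePlace L // v.IsComplex} × Fin 2)) →₀ ℕ) → ℂ → ℂ),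
      (∀ m, Differentiable ℂ fun w : ℂ => (A m w)⁻¹) ∧
      (∀ m ∈ ι, ∀ w : ℂ, 0 < w.re → ∀ k : Matrix.unitaryGroup (Fin 2) (mixedSpace L),
        Integrable (fun x : (mixedSpace L)ˣ => Φ m (fun l => (x : mixedSpace L) * (k : Matrix (Fin 2) (Fin 2) (mixedSpace L)) 1 l) *
          ((mixedEmbedding.norm ((x : (mixedSpace L)ˣ) : mixedSpace L) : ℝ) : ℂ) ^ w) μ) ∧
      ∀ w : ℂ, 0 < w.re → ∀ k : Matrix.unitaryGroup (Fin 2) (mixedSpace L),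
        F₀ k = ∑ m ∈ ι, (A m w)⁻¹ * ∫ x : (mixedSpace L)ˣ, Φ m (fun l => (x : mixedSpace L) * (k : Matrix (Fin 2) (Fin 2) (mixedSpace L)) 1 l) *
          ((mixedEmbedding.norm ((x : (mixedSpace L)ˣ) : mixedSpace L) : ℝ) : ℂ) ^ w ∂μ := by
  -- the polynomial `Q = F₀ ∘ κ` in the bottom-row coordinates (§3)
  set Q : MvPolynomial (({v : InfinitePlace L // v.IsComplex} × Fin 2) ⊕ ({v : InfinitePlace L // v.IsComplex} × Fin 2)) ℂ := bind₁ (Sum.elim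
      (fun w : {v : InfinitePlace L // v.IsComplex} × (Fin 2 × Fin 2) =>
        (!![X (Sum.inr (w.1, 1)), -X (Sum.inr (w.1, 0)); X (Sum.inl (w.1, 0)), X (Sum.inl (w.1, 1))] :
          Matrix (Fin 2) (Fin 2) (MvPolynomial (({v : InfinitePlace L // v.IsComplex} × Fin 2) ⊕ ({v : InfinitePlace L // v.IsComplex} × Fin 2)) ℂ)) w.2.1 w.2.2)
      (fun w : {v : InfinitePlace L // v.IsComplex} × (Fin 2 × Fin 2) =>
        (!![X (Sum.inl (w.1, 1)), -X (Sum.inl (w.1, 0)); X (Sum.inr (w.1, 0)), X (Sum.inr (w.1, 1))] :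
          Matrix (Fin 2) (Fin 2) (MvPolynomial (({v : InfinitePlace L // v.IsComplex} × Fin 2) ⊕ ({v : InfinitePlace L // v.IsComplex} × Fin 2)) ℂ)) w.2.1 w.2.2)) P
    with hQ
  have hFκ : ∀ {x : Fin 2 → mixedSpace L} (hx : x 0 * star (x 0) + x 1 * star (x 1) = 1),
      F₀ ⟨!![star (x 1), -star (x 0); x 0, x 1], kappa_mem_unitaryGroup hx⟩ =
        eval (Sum.elim (fun vl : {v : InfinitePlace L // v.IsComplex} × Fin 2 => (x vl.2).2 vl.1)
          (fun vl : {v : InfinitePlace L // v.IsComplex} × Fin 2 => conj ((x vl.2).2 vl.1))) Q := by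
    intro x hx
    rw [hF, hQ, ← eval_kappa P x]
  -- the data from (β4-iv) A
  obtain ⟨cμ, hcμ, HA⟩ := exists_integral_monomial_gaussian (L := L) μ
  choose Φ hΦ using fun m : (({v : InfinitePlace L // v.IsComplex} × Fin 2) ⊕ ({v : InfinitePlace L // v.IsComplex} × Fin 2)) →₀ ℕ =>
    exists_schwartzMap_eval_mul_gaussian (L := L) (monomial m (Q.coeff m))
  refine ⟨Q.support.filter (fun m => ∀ v, ∑ l, m (Sum.inl (v, l)) = ∑ l, m (Sum.inr (v, l))), Φ,
    fun m w => (cμ : ℂ) * ∏ v, ((π : ℂ) * ((1 / ((2 * π : ℝ) : ℂ)) ^ (w + (∑ l, m (Sum.inl (v, l)) : ℕ)) * Complex.Gamma (w + (∑ l, m (Sum.inl (v, l)) : ℕ)))),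
    fun m => ?_, fun m hm w hw k => ?_, fun w hw k => ?_⟩
  · -- `hAinv`: the inverse coefficient is entire
    have heq : (fun w : ℂ => ((cμ : ℂ) * ∏ v, ((π : ℂ) * ((1 / ((2 * π : ℝ) : ℂ)) ^ (w + (∑ l, m (Sum.inl (v, l)) : ℕ)) *
        Complex.Gamma (w + (∑ l, m (Sum.inl (v, l)) : ℕ)))))⁻¹) =
        fun w : ℂ => (cμ : ℂ)⁻¹ * ∏ v, ((π : ℂ) * ((1 / ((2 * π : ℝ) : ℂ)) ^ (w + (∑ l, m (Sum.inl (v, l)) : ℕ)) *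
          Complex.Gamma (w + (∑ l, m (Sum.inl (v, l)) : ℕ))))⁻¹ := by
      funext w
      rw [mul_inv, Finset.prod_inv_distrib]
    rw [heq]
    exact (Differentiable.fun_finsetProd fun v _ => differentiable_gammaFactorC_inv _).const_mul _
  · -- `hgi`
    exact (HA m (fun v => ∑ l, m (Sum.inl (v, l))) (fun v => rfl) (fun v => ((Finset.mem_filter.1 hm).2 v).symm) (Q.coeff m) w hw _
      (norm_sq_add_of_row_mul_star (row_one_mul_star_eq_one k)) (Φ m) (hΦ m)).1
  · -- the identity
    have hx : (k : Matrix (Fin 2) (Fin 2) (mixedSpace L)) 1 0 * star ((k : Matrix (Fin 2) (Fin 2) (mixedSpace L)) 1 0) +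
        (k : Matrix (Fin 2) (Fin 2) (mixedSpace L)) 1 1 * star ((k : Matrix (Fin 2) (Fin 2) (mixedSpace L)) 1 1) = 1 := row_one_mul_star_eq_one k
    have h1 : F₀ k = eval (Sum.elim (fun vl : {v : InfinitePlace L // v.IsComplex} × Fin 2 => ((k : Matrix (Fin 2) (Fin 2) (mixedSpace L)) 1 vl.2).2 vl.1)
        (fun vl : {v : InfinitePlace L // v.IsComplex} × Fin 2 => conj (((k : Matrix (Fin 2) (Fin 2) (mixedSpace L)) 1 vl.2).2 vl.1))) Q := by
      rw [apply_eq_apply_kappa hB k]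
      exact hFκ hx
    -- torus invariance of `Q` at the bottom row: `u ∈ U(1)^{r₂}` is a unitary scalar of `mixedSpace L`
    have hcirc : ∀ u : {v : InfinitePlace L // v.IsComplex} → Circle,
        eval (Sum.elim (fun vl : {v : InfinitePlace L // v.IsComplex} × Fin 2 => (u vl.1 : ℂ) * ((k : Matrix (Fin 2) (Fin 2) (mixedSpace L)) 1 vl.2).2 vl.1)
          (fun vl : {v : InfinitePlace L // v.IsComplex} × Fin 2 => conj ((u vl.1 : ℂ) * ((k : Matrix (Fin 2) (Fin 2) (mixedSpace L)) 1 vl.2).2 vl.1))) Q =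
        eval (Sum.elim (fun vl : {v : InfinitePlace L // v.IsComplex} × Fin 2 => ((k : Matrix (Fin 2) (Fin 2) (mixedSpace L)) 1 vl.2).2 vl.1)
          (fun vl : {v : InfinitePlace L // v.IsComplex} × Fin 2 => conj (((k : Matrix (Fin 2) (Fin 2) (mixedSpace L)) 1 vl.2).2 vl.1))) Q := by
      intro u
      set s : mixedSpace L := (fun _ => (1 : ℝ), fun v => ((u v : Circle) : ℂ)) with hs
      have hsu : s ∈ unitary (mixedSpace L) := by
        rw [Unitary.mem_iff]
        have h : star s * s = 1 := Prod.ext (funext fun w => by simp [hs]) (funext fun v => by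
          simp only [hs, Prod.snd_mul, Prod.snd_star, Pi.mul_apply, Pi.star_apply, Prod.snd_one, Pi.one_apply, Complex.star_def,
            ← Circle.coe_inv_eq_conj, ← Circle.coe_mul, inv_mul_cancel, Circle.coe_one])
        exact ⟨h, by rw [mul_comm]; exact h⟩
      have h2 := hFκ (smul_row_mul_star_eq_one hsu hx)
      rw [apply_kappa_smul hB hsu hx, hFκ hx] at h2
      exact h2.symm
    rw [h1, eval_eq_sum_balanced_of_torus_invariant Q _ hcirc]
    refine Finset.sum_congr rfl fun m hm => ?_
    have hbal := (Finset.mem_filter.1 hm).2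
    obtain ⟨-, hval⟩ := HA m (fun v => ∑ l, m (Sum.inl (v, l))) (fun v => rfl) (fun v => (hbal v).symm) (Q.coeff m) w hw _
      (norm_sq_add_of_row_mul_star hx) (Φ m) (hΦ m)
    have hA0 : (cμ : ℂ) * ∏ v, ((π : ℂ) * ((1 / ((2 * π : ℝ) : ℂ)) ^ (w + (∑ l, m (Sum.inl (v, l)) : ℕ)) *
        Complex.Gamma (w + (∑ l, m (Sum.inl (v, l)) : ℕ)))) ≠ 0 := by
      refine mul_ne_zero (by exact_mod_cast hcμ.ne') (Finset.prod_ne_zero_iff.2 fun v _ => gammaFactorC_ne_zero ?_)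
      simp only [add_re, natCast_re]
      linarith [(Nat.cast_nonneg (∑ l, m (Sum.inl (v, l))) : (0 : ℝ) ≤ (∑ l, m (Sum.inl (v, l)) : ℕ))]
    rw [hval, ← mul_assoc, inv_mul_cancel₀ hA0, one_mul]

end Main

end Summit.HodgeConjecture.HodgeConjecture.Cruxes.HLiu418.K2LiuGL2GodementSectionOfFlatArchCM

end
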